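import Summits.ABC.ABC.Theorems.TwistAmplificationMazurKaneLawToolkitDefs

/-!
# Crux `TwistAmplification.MazurKaneLaw` (stmt-ABC-2757), line `fibre-toolkit-lp-wall-map`: the structure of the WILD region

Support file for the open stub S4 `wallResidual` (and S5 `deepResidual`): what a WILD shape datum (`Toolkit.Wild` = no
certificate of the fibre toolkit reaches the exponent `θ = s − 1 + τ`) must look like. Everything here is PROVED; it turns
the line card's prose description of the residue ("the wall triangle `p₁ < 1 − Δ`, `p₂ < 1 − Δ ∨ e > 3Δ`,
`2p₁ + p₂ ≥ 3L − 3 + e`, `L > 3(s−1)/2`, tail `< 2(2−s)`…") into kernel-checked inequalities on the exponents of an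
admissible wild datum, so that a lever for S4/S5 (or a refuter) knows exactly which boxes remain:

* `not_certified_iff` — `¬ Certified` unfolded: every trivial / subset-GoN / Fourier / determinant certificate fails;
* `radExp_le_of_admissible` — `L ≤ s + 3ε′` (`Λ = 2C₀`);
* `moment_identity` — `Σⱼ (j+1)(αⱼ+βⱼ+γⱼ) = 3 − e − (log_Λ c₁ + log_Λ c₂ + log_Λ c₃)` with `0 ≤ log_Λ cⱼ ≤ ε′/2`;
* `wild_wall_structure` (registered sub-goal of stmt-ABC-2757) — for an admissible WILD datum with `3ε′ < τ`:
  `3θ < 2L` (no trivial certificate), `P_lin < L − θ` (Kane's lattices fail only through their "+1" branch),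
  `P_sq < L − θ ∨ 3(θ + 1 − L) < e` (the sharp conic fails through its "+1" branch unless the datum is LOPSIDED),
  and the moment bounds `P_lin + 2P_sq + 3·tail ≤ 3 − e`, `3 − e − 3ε′/2 ≤ Σ (j+1)pⱼ`
  (`P_lin`, `P_sq`, `tail` = exponent mass on the linear coordinate `0`, the square coordinate `1`, the coordinates `≥ 2`).
  At the binding level `L = s + O(ε′)`, `θ = s − 1 + τ`: `P_lin < 1`, `P_sq < 1 ∨ e > 0⁺`, `2P_lin + P_sq ≥ 3L − 3 + e`,
  i.e. the wall triangle of the line card, whose worst point is the wall family `a, b, c = u x² w³`.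

References: BBLT arXiv:2410.12234v2 §6 (dictionary); line card `Cruxes/MazurKaneLaw/Lines/fibre-toolkit-lp-wall-map.md` §Map item 1.
-/

noncomputable section

-- `Summit.<Summit>.<Problem>` is the mandated summit-side namespace; for the single-conjunct summit `ABC` the duplicate
-- `ABC.ABC` is deliberate (the lakefile sets the same option tree-wide).
set_option linter.dupNamespace false

open Finset
open Literature.NumberTheory.DiophantineGeometry
open Literature.NumberTheory.DiophantineGeometry.AbcShapes
open Summit.ABC.ABC.Theorems.MazurKaneLaw.Toolkit

namespace Summit.ABC.ABC.Theorems.MazurKaneLaw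

/-! ### `¬ Certified`, unfolded -/

/-- A datum is NOT certified at `θ` iff every certificate of the kit fails: the three trivial sums exceed `θ`, every
index-set choice of the geometry tool has a branch exceeding `θ`, every saved-set choice of the Fourier tool exceeds `θ`,
and at every coordinate `i ≥ 1` the determinant tool has a branch exceeding `θ`. -/
theorem not_certified_iff {M : ℕ} (Λ θ : ℝ) (c₁ c₂ c₃ : ℕ) (X Y Z : Fin M → ℕ) :
    ¬ Certified Λ θ c₁ c₂ c₃ X Y Z ↔
      ((θ < ∑ i, expo Λ X i + ∑ i, expo Λ Y i) ∧ (θ < ∑ i, expo Λ X i + ∑ i, expo Λ Z i) ∧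
          (θ < ∑ i, expo Λ Y i + ∑ i, expo Λ Z i)) ∧
      (∀ I J K : Finset (Fin M),
          θ < radExp Λ X Y Z - (∑ i ∈ I, expo Λ X i + ∑ i ∈ J, expo Λ Y i + ∑ i ∈ K, expo Λ Z i) ∨
          θ < radExp Λ X Y Z - 1 +
            (∑ i ∈ I, (i : ℝ) * expo Λ X i + ∑ i ∈ J, (i : ℝ) * expo Λ Y i + ∑ i ∈ K, (i : ℝ) * expo Λ Z i)) ∧
      (∀ (SU SV SW : Finset (Fin M)) (eU eV eW : ℕ), 2 ≤ eU → 2 ≤ eV → 2 ≤ eW →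
          (∀ i ∈ SU, eU ∣ (i : ℕ) + 1) → (∀ i ∈ SV, eV ∣ (i : ℕ) + 1) → (∀ i ∈ SW, eW ∣ (i : ℕ) + 1) →
          θ < (4 * radExp Λ X Y Z - (∑ i ∈ SU, expo Λ X i + ∑ i ∈ SV, expo Λ Y i + ∑ i ∈ SW, expo Λ Z i)) / 6) ∧
      (∀ i : Fin M, 1 ≤ (i : ℕ) →
          θ < radExp Λ X Y Z - (expo Λ X i + expo Λ Y i + expo Λ Z i) ∨
          θ < radExp Λ X Y Z - 1 +
            ((((i : ℕ) : ℝ) - 1) * (expo Λ X i + expo Λ Y i + expo Λ Z i) + deficiency Λ c₁ c₂ c₃ X Y Z) / 3) := by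
  simp only [Certified, TrivialCertifies, GeometryCertifies, FourierCertifies, DeterminantCertifies, not_or, not_exists,
    not_and, not_le]
  constructor
  · rintro ⟨⟨h1, h2, h3⟩, hG, hF, hD⟩
    refine ⟨⟨h1, h2, h3⟩, fun I J K => ?_, fun SU SV SW eU eV eW heU heV heW hU hV hW => ?_, fun i hi => ?_⟩
    · by_cases h : radExp Λ X Y Z - (∑ i ∈ I, expo Λ X i + ∑ i ∈ J, expo Λ Y i + ∑ i ∈ K, expo Λ Z i) ≤ θ
      · exact Or.inr (hG I J K h)
      · exact Or.inl (not_le.mp h)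
    · exact hF SU SV SW eU eV eW heU heV heW hU hV hW
    · by_cases h : radExp Λ X Y Z - (expo Λ X i + expo Λ Y i + expo Λ Z i) ≤ θ
      · exact Or.inr (hD i hi h)
      · exact Or.inl (not_le.mp h)
  · rintro ⟨⟨h1, h2, h3⟩, hG, hF, hD⟩
    refine ⟨⟨h1, h2, h3⟩, fun I J K hIJK => ?_, fun SU SV SW eU eV eW heU heV heW hU hV hW => ?_, fun i hi h1i => ?_⟩
    · rcases hG I J K with h | h
      · exact absurd hIJK (not_le.mpr h)
      · exact h
    · exact hF SU SV SW eU eV eW heU heV heW hU hV hW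
    · rcases hD i hi with h | h
      · exact absurd h1i (not_le.mpr h)
      · exact h

/-! ### Admissible data: the radical exponent and the moment identity -/

/-- `L = log_Λ ∏ XᵢYᵢZᵢ ≤ s + 3ε′` for data admissible for `(s, ε′)` (`Λ = 2C₀`). -/
theorem radExp_le_of_admissible {s ε : ℝ} {M : ℕ} {C₀ c₁ c₂ c₃ : ℕ} {X Y Z : Fin M → ℕ}
    (hA : Admissible s ε C₀ c₁ c₂ c₃ X Y Z) : radExp (scale C₀) X Y Z ≤ s + 3 * ε := by
  have hΛ : 1 < scale C₀ := by
    have : (1 : ℝ) ≤ C₀ := by exact_mod_cast hA.one_le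
    rw [scale]; linarith
  have hprod : Real.logb (scale C₀) (∏ i, ((X i : ℝ) * Y i * Z i)) ≤ s + 3 * ε := by
    have h0 : 0 < ∏ i, ((X i : ℝ) * Y i * Z i) := prod_pos fun i _ => by
      have := hA.X_pos i; have := hA.Y_pos i; have := hA.Z_pos i; positivity
    calc Real.logb (scale C₀) (∏ i, ((X i : ℝ) * Y i * Z i))
        ≤ Real.logb (scale C₀) ((scale C₀) ^ (s + 3 * ε)) :=
          Real.logb_le_logb_of_le hΛ h0 (by simpa [scale] using hA.prod_le)
      _ = s + 3 * ε := Real.logb_rpow (by linarith) hΛ.ne'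
  have hsum : Real.logb (scale C₀) (∏ i, ((X i : ℝ) * Y i * Z i)) = radExp (scale C₀) X Y Z := by
    rw [radExp, Real.logb, Real.log_prod]
    · rw [sum_div]
      refine sum_congr rfl fun i _ => ?_
      have hx : (0 : ℝ) < X i := by exact_mod_cast hA.X_pos i
      have hy : (0 : ℝ) < Y i := by exact_mod_cast hA.Y_pos i
      have hz : (0 : ℝ) < Z i := by exact_mod_cast hA.Z_pos i
      rw [Real.log_mul (by positivity) hz.ne', Real.log_mul hx.ne' hy.ne', expo, expo, expo, Real.logb, Real.logb,
        Real.logb]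
      ring
    · intro i _
      have := hA.X_pos i; have := hA.Y_pos i; have := hA.Z_pos i; positivity
  linarith

/-- THE MOMENT IDENTITY: `Σⱼ (j+1)(αⱼ + βⱼ + γⱼ) = 3 − e − (log_Λ c₁ + log_Λ c₂ + log_Λ c₃)` for positive data
(`e = deficiency`, `Λ` any base): `log_Λ (cⱼ · ∏ xᵢ^{i+1}) = log_Λ cⱼ + Σ (i+1) αᵢ`. -/
theorem moment_identity {M : ℕ} (Λ : ℝ) {c₁ c₂ c₃ : ℕ} (hc₁ : 0 < c₁) (hc₂ : 0 < c₂) (hc₃ : 0 < c₃)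
    {X Y Z : Fin M → ℕ} (hX : ∀ i, 0 < X i) (hY : ∀ i, 0 < Y i) (hZ : ∀ i, 0 < Z i) :
    ∑ i : Fin M, (((i : ℕ) : ℝ) + 1) * (expo Λ X i + expo Λ Y i + expo Λ Z i) =
      3 - deficiency Λ c₁ c₂ c₃ X Y Z - (Real.logb Λ c₁ + Real.logb Λ c₂ + Real.logb Λ c₃) := by
  rw [deficiency, logb_natMul hc₁ (shapeVal_pos hX), logb_natMul hc₂ (shapeVal_pos hY),
    logb_natMul hc₃ (shapeVal_pos hZ), logb_shapeVal hX, logb_shapeVal hY, logb_shapeVal hZ]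
  simp only [mul_add, sum_add_distrib]
  ring

/-- Cofactor exponents are small: `0 ≤ log_Λ cⱼ ≤ ε′/2` for `1 ≤ cⱼ ≤ Λ^{ε′/2}`, `Λ > 1`. -/
theorem logb_cofactor_bounds {Λ ε : ℝ} (hΛ : 1 < Λ) {c : ℕ} (hc : 0 < c) (hle : (c : ℝ) ≤ Λ ^ (ε / 2)) :
    0 ≤ Real.logb Λ c ∧ Real.logb Λ c ≤ ε / 2 := by
  refine ⟨Real.logb_nonneg hΛ (by exact_mod_cast hc), ?_⟩
  calc Real.logb Λ c ≤ Real.logb Λ (Λ ^ (ε / 2)) := Real.logb_le_logb_of_le hΛ (by exact_mod_cast hc) hle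
    _ = ε / 2 := Real.logb_rpow (by linarith) hΛ.ne'

/-- Splitting the weighted mass: with `i₀ ≠ i₁` the coordinates `0` and `1`,
`Σⱼ (j+1) pⱼ ≥ p_{i₀} + 2 p_{i₁} + 3 · Σ_{j ∉ {i₀,i₁}} pⱼ` for non-negative masses. -/
theorem weighted_sum_ge {M : ℕ} (p : Fin M → ℝ) (hp : ∀ i, 0 ≤ p i) (i₀ i₁ : Fin M) (h0 : (i₀ : ℕ) = 0)
    (h1 : (i₁ : ℕ) = 1) :
    p i₀ + 2 * p i₁ + 3 * ∑ i ∈ ({i₀, i₁} : Finset (Fin M))ᶜ, p i ≤ ∑ i : Fin M, (((i : ℕ) : ℝ) + 1) * p i := by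
  classical
  have hne : i₀ ≠ i₁ := fun h => by have := congrArg (fun i : Fin M => (i : ℕ)) h; simp [h0, h1] at this
  rw [← sum_add_sum_compl ({i₀, i₁} : Finset (Fin M)), sum_pair hne, h0, h1, mul_sum]
  push_cast
  have htail : ∑ i ∈ ({i₀, i₁} : Finset (Fin M))ᶜ, 3 * p i ≤ ∑ i ∈ ({i₀, i₁} : Finset (Fin M))ᶜ, (((i : ℕ) : ℝ) + 1) * p i := by
    refine sum_le_sum fun i hi => mul_le_mul_of_nonneg_right ?_ (hp i)
    rw [mem_compl, mem_insert, mem_singleton, not_or] at hi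
    have h2 : 2 ≤ (i : ℕ) := by
      rcases Nat.lt_or_ge (i : ℕ) 2 with h | h
      · exfalso
        interval_cases hi' : (i : ℕ)
        · exact hi.1 (Fin.ext (by rw [hi', h0]))
        · exact hi.2 (Fin.ext (by rw [hi', h1]))
      · exact h
    have : (2 : ℝ) ≤ (i : ℕ) := by exact_mod_cast h2
    linarith
  linarith

/-! ### The registered sub-goal: the wall structure of an admissible wild datum -/

/-- **Wall structure of the wild region** (registered sub-goal `wild_wall_structure` of stmt-ABC-2757; support for the open stubs
`wallResidual` / `deepResidual`). For a datum admissible for `(s, ε′)` at scale `C₀` which is WILD at `(s, τ)` with `3ε′ < τ`, writing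
`Λ = 2C₀`, `θ = s − 1 + τ`, `L = radExp`, `e = deficiency`, `P_lin`/`P_sq` = the exponent masses `α+β+γ` on the linear coordinate `i₀ = 0`
and the square coordinate `i₁ = 1`: (1) `3θ < 2L` (no trivial certificate); (2) `P_lin < L − θ` (Kane's lattices `I=J=K={0}` fail
through their "+1" branch, the volume branch `L − 1 ≤ s − 1 + 3ε′ < θ` being certified); (3) `P_sq < L − θ ∨ 3(θ + 1 − L) < e` (the
sharp conic at level 2 fails through its "+1" branch unless the datum is lopsided, `e` large); (4) the moment bounds
`P_lin + 2P_sq + 3·(mass on coordinates ≥ 2) ≤ 3 − e` and `3 − e − 3ε′/2 ≤ Σⱼ (j+1) pⱼ`. -/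
theorem wild_wall_structure : ∀ (s ε' τ : ℝ), 0 < ε' → 3 * ε' < τ → ∀ (C₀ c₁ c₂ c₃ : ℕ) (X Y Z : Fin (Literature.NumberTheory.DiophantineGeometry.AbcShapes.numShapes ε') → ℕ) (i₀ i₁ : Fin (Literature.NumberTheory.DiophantineGeometry.AbcShapes.numShapes ε')), (i₀ : ℕ) = 0 → (i₁ : ℕ) = 1 → Literature.NumberTheory.DiophantineGeometry.AbcShapes.Admissible s ε' C₀ c₁ c₂ c₃ X Y Z → Summit.ABC.ABC.Theorems.MazurKaneLaw.Toolkit.Wild (Literature.NumberTheory.DiophantineGeometry.AbcShapes.numShapes ε') s τ C₀ c₁ c₂ c₃ X Y Z → (3 * (s - 1 + τ) < 2 * Summit.ABC.ABC.Theorems.MazurKaneLaw.Toolkit.radExp (Summit.ABC.ABC.Theorems.MazurKaneLaw.Toolkit.scale C₀) X Y Z) ∧ (Literature.NumberTheory.DiophantineGeometry.AbcShapes.expo (Summit.ABC.ABC.Theorems.MazurKaneLaw.Toolkit.scale C₀) X i₀ + Literature.NumberTheory.DiophantineGeometry.AbcShapes.expo (Summit.ABC.ABC.Theorems.MazurKaneLaw.Toolkit.scale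 C₀) Y i₀ + Literature.NumberTheory.DiophantineGeometry.AbcShapes.expo (Summit.ABC.ABC.Theorems.MazurKaneLaw.Toolkit.scale C₀) Z i₀ < Summit.ABC.ABC.Theorems.MazurKaneLaw.Toolkit.radExp (Summit.ABC.ABC.Theorems.MazurKaneLaw.Toolkit.scale C₀) X Y Z - (s - 1 + τ)) ∧ (Literature.NumberTheory.DiophantineGeometry.AbcShapes.expo (Summit.ABC.ABC.Theorems.MazurKaneLaw.Toolkit.scale C₀) X i₁ + Literature.NumberTheory.DiophantineGeometry.AbcShapes.expo (Summit.ABC.ABC.Theorems.MazurKaneLaw.Toolkit.scale C₀) Y i₁ + Literature.NumberTheory.DiophantineGeometry.AbcShapes.expo (Summit.ABC.ABC.Theorems.MazurKaneLaw.Toolkit.scale C₀) Z i₁ < Summit.ABC.ABC.Theorems.MazurKaneLaw.Toolkit.radExp (Summit.ABC.ABC.Theorems.MazurKaneLaw.Toolkit.scale C₀) X Y Z - (s - 1 + τ) ∨ 3 * ((s - 1 + τ) + 1 - Summit.ABC.ABC.Theorems.MazurKaneLaw.Toolkit.radExp (Summit.ABC.ABC.Theorems.MazurKaneLaw.Toolkit.scale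 C₀) X Y Z) < Summit.ABC.ABC.Theorems.MazurKaneLaw.Toolkit.deficiency (Summit.ABC.ABC.Theorems.MazurKaneLaw.Toolkit.scale C₀) c₁ c₂ c₃ X Y Z) ∧ ((Literature.NumberTheory.DiophantineGeometry.AbcShapes.expo (Summit.ABC.ABC.Theorems.MazurKaneLaw.Toolkit.scale C₀) X i₀ + Literature.NumberTheory.DiophantineGeometry.AbcShapes.expo (Summit.ABC.ABC.Theorems.MazurKaneLaw.Toolkit.scale C₀) Y i₀ + Literature.NumberTheory.DiophantineGeometry.AbcShapes.expo (Summit.ABC.ABC.Theorems.MazurKaneLaw.Toolkit.scale C₀) Z i₀) + 2 * (Literature.NumberTheory.DiophantineGeometry.AbcShapes.expo (Summit.ABC.ABC.Theorems.MazurKaneLaw.Toolkit.scale C₀) X i₁ + Literature.NumberTheory.DiophantineGeometry.AbcShapes.expo (Summit.ABC.ABC.Theorems.MazurKaneLaw.Toolkit.scale C₀) Y i₁ + Literature.NumberTheory.DiophantineGeometry.AbcShapes.expo (Summit.ABC.ABC.Theorems.MazurKaneLaw.Toolkit.scale C₀) Z i₁) + 3 * (∑ i ∈ ({i₀, i₁}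 : Finset (Fin (Literature.NumberTheory.DiophantineGeometry.AbcShapes.numShapes ε')))ᶜ, (Literature.NumberTheory.DiophantineGeometry.AbcShapes.expo (Summit.ABC.ABC.Theorems.MazurKaneLaw.Toolkit.scale C₀) X i + Literature.NumberTheory.DiophantineGeometry.AbcShapes.expo (Summit.ABC.ABC.Theorems.MazurKaneLaw.Toolkit.scale C₀) Y i + Literature.NumberTheory.DiophantineGeometry.AbcShapes.expo (Summit.ABC.ABC.Theorems.MazurKaneLaw.Toolkit.scale C₀) Z i)) ≤ 3 - Summit.ABC.ABC.Theorems.MazurKaneLaw.Toolkit.deficiency (Summit.ABC.ABC.Theorems.MazurKaneLaw.Toolkit.scale C₀) c₁ c₂ c₃ X Y Z) ∧ (3 - Summit.ABC.ABC.Theorems.MazurKaneLaw.Toolkit.deficiency (Summit.ABC.ABC.Theorems.MazurKaneLaw.Toolkit.scale C₀) c₁ c₂ c₃ X Y Z - 3 * ε' / 2 ≤ ∑ i : Fin (Literature.NumberTheory.DiophantineGeometry.AbcShapes.numShapes ε'), (((i : ℕ) : ℝ) + 1) * (Literature.NumberTheory.DiophantineGeometry.AbcShapes.expo (Summit.ABC.ABC.Theorems.MazurKaneLaw.Toolkit.scale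 C₀) X i + Literature.NumberTheory.DiophantineGeometry.AbcShapes.expo (Summit.ABC.ABC.Theorems.MazurKaneLaw.Toolkit.scale C₀) Y i + Literature.NumberTheory.DiophantineGeometry.AbcShapes.expo (Summit.ABC.ABC.Theorems.MazurKaneLaw.Toolkit.scale C₀) Z i)) := by
  intro s ε' τ hε hτ C₀ c₁ c₂ c₃ X Y Z i₀ i₁ h0 h1 hA hW
  classical
  set Λ := scale C₀ with hΛdef
  have hΛ : 1 < Λ := by
    have : (1 : ℝ) ≤ C₀ := by exact_mod_cast hA.one_le
    rw [hΛdef, scale]; linarith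
  have hL : radExp Λ X Y Z ≤ s + 3 * ε' := radExp_le_of_admissible hA
  -- unfold wildness
  have hW' := (not_certified_iff Λ (s - 1 + τ) c₁ c₂ c₃ X Y Z).1 hW
  obtain ⟨⟨hT1, hT2, hT3⟩, hG, -, hD⟩ := hW'
  -- (1) no trivial certificate
  have h1' : 3 * (s - 1 + τ) < 2 * radExp Λ X Y Z := by
    have : radExp Λ X Y Z = ∑ i, expo Λ X i + ∑ i, expo Λ Y i + ∑ i, expo Λ Z i := by
      rw [radExp, sum_add_distrib, sum_add_distrib]
    linarith
  -- (2) Kane's lattices `I = J = K = {i₀}` fail through the "+1" branch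
  have h2' : expo Λ X i₀ + expo Λ Y i₀ + expo Λ Z i₀ < radExp Λ X Y Z - (s - 1 + τ) := by
    rcases hG {i₀} {i₀} {i₀} with h | h
    · simp only [sum_singleton] at h; linarith
    · simp only [sum_singleton, h0, Nat.cast_zero, zero_mul, add_zero] at h; linarith
  -- (3) the sharp conic at `i₁` fails through the "+1" branch unless lopsided
  have h3' : expo Λ X i₁ + expo Λ Y i₁ + expo Λ Z i₁ < radExp Λ X Y Z - (s - 1 + τ) ∨
      3 * ((s - 1 + τ) + 1 - radExp Λ X Y Z) < deficiency Λ c₁ c₂ c₃ X Y Z := by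
    rcases hD i₁ (by rw [h1]) with h | h
    · left; linarith
    · right
      simp only [h1, Nat.cast_one, sub_self, zero_mul, zero_add] at h
      linarith
  -- (4) the moment bounds
  have hmom := moment_identity Λ hA.pos₁ hA.pos₂ hA.pos₃ hA.X_pos hA.Y_pos hA.Z_pos
  obtain ⟨hc1l, hc1u⟩ := logb_cofactor_bounds hΛ hA.pos₁ (by simpa [hΛdef, scale] using hA.le₁)
  obtain ⟨hc2l, hc2u⟩ := logb_cofactor_bounds hΛ hA.pos₂ (by simpa [hΛdef, scale] using hA.le₂)
  obtain ⟨hc3l, hc3u⟩ := logb_cofactor_bounds hΛ hA.pos₃ (by simpa [hΛdef, scale] using hA.le₃)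
  have hp : ∀ i, 0 ≤ expo Λ X i + expo Λ Y i + expo Λ Z i := fun i =>
    add_nonneg (add_nonneg (expo_nonneg hΛ hA.X_pos i) (expo_nonneg hΛ hA.Y_pos i)) (expo_nonneg hΛ hA.Z_pos i)
  have hsplit := weighted_sum_ge (fun i => expo Λ X i + expo Λ Y i + expo Λ Z i) hp i₀ i₁ h0 h1
  refine ⟨h1', h2', h3', ?_, ?_⟩
  · linarith
  · linarith

end Summit.ABC.ABC.Theorems.MazurKaneLaw

end
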